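import Literature.AlgebraicGeometry.Motives.UniversalHypersurfaceTotalSpaceOverCoordinates
import Literature.AlgebraicGeometry.Motives.UniversalHypersurfaceRegularLocusSubmersion
import Mathlib.Topology.Maps.Proper.Basic
import HarnessLib

/-!
# The coefficient map `𝒴(ℂ) → ℂ^N` is proper; the fibre-singular points over a small ball of forms stay near a given set

Family `hodge`, layer `Literature/AlgebraicGeometry/Motives`; sequel of `UniversalHypersurfaceTotalSpaceOverCoordinates` (coordinates
`(b, [z])` on the whole universal hypersurface `𝒴(ℂ)` and the regular locus `𝒴°(ℂ) ⊆ 𝒴(ℂ)` in them) and of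
`UniversalHypersurfaceRegularLocusSubmersion` (`baseCoordFun : S^d(ℂ) → ℂ^N`). The compact-support arguments for vector fields on the
manifold `𝒴°(ℂ)` of the degeneration programme (`HodgeTheory/CyclicCoverNodalMeridianLocalMonodromyBound`) rest on:

* §1 `isHomeomorph_baseCoordFun` — `S^d(ℂ) → ℂ^N` is a homeomorphism (bijective; open by Clements–Osgood,
  `ComplexPointsRegularInjectiveChart`); `isProperMap_baseCoordFun`;
* §2 `tOverToAffine : 𝒴 → S^d` (proper), `isProperMap_tCoeff` — **`P ↦ (b_m(P))_m : 𝒴(ℂ) → ℂ^N` is a proper map**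
  (`AlgPoints.isProperMap_map`, SGA1 XII Prop. 3.2 (v)); `tCoeff` is continuous;
* §3 `exists_open_nhds_inter_preimage_subset` — for a proper `π : X → Y`, a closed `S ⊆ X` and an open `N ⊇ S ∩ π⁻¹(y₀)` there is an
  open `V ∋ y₀` with `S ∩ π⁻¹(V) ⊆ N` (proper maps are closed);
* §4 `isClosed_singularPoints`, `exists_open_nhds_singular_subset` — the fibre-singular points `𝒴(ℂ) ∖ 𝒴°(ℂ)` form a closed set, and
  **if the singular points over `b₀` lie in an open `N`, so do the singular points over all `b` near `b₀`** (upper semicontinuity);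
* §5 `isCompact_setOf_regCoeff_mem_of_forall_singular` — **for a compact `K ⊆ ℂ^N` such that every singular point over `K` lies in the
  open `N`, the set `{Q ∈ 𝒴°(ℂ) | b(Q) ∈ K, Q ∉ N}` is COMPACT** (a closed subset of the compact `b⁻¹(K) ⊆ 𝒴(ℂ)` contained in the image
  of the open embedding `𝒴°(ℂ) ↪ 𝒴(ℂ)`).

Everything is proved; the one definition (`tOverToAffine`) is concrete; no named facts.

## References

* [SGA1] A. Grothendieck, M. Raynaud, SGA 1, Exp. XII Prop. 3.2 (v) (`f` propre ⇒ `f^an` propre), Prop. 3.1 (xi).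
* [VoisinHodgeII2003] C. Voisin, Hodge Theory and Complex Algebraic Geometry II (2003), §6.2.1, §2.3.1 (Lefschetz degenerations: the
  critical points of the pencil).
* [SerreGAGA1956] J.-P. Serre, Géométrie algébrique et géométrie analytique, Ann. Inst. Fourier 6 (1956), §2 n°5.
-/

noncomputable section

open CategoryTheory AlgebraicGeometry MvPolynomial TopologicalSpace Topology Set

universe u

namespace Literature.AlgebraicGeometry.Motives.UniversalHypersurface

/-! ### §1 `S^d(ℂ) → ℂ^N` is a homeomorphism -/

section Base

variable (n d : ℕ)

/-- The algebra map underlying `ofAlgHom e` is `e` (on elements). [cite: SerreGAGA1956, §2 n°5] -/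
theorem toAlgHom_ofAlgHom_apply {k : Type u} [Field k] {R L : Type u} [CommRing R] [Algebra k R] [Field L] [Algebra k L]
    (e : R →ₐ[k] L) (x : R) : AlgPoints.toAlgHom (AlgPoints.ofAlgHom e) x = e x := by
  change (Spec.preimage (AlgPoints.ofAlgHom e).toSpecHom).hom x = e x
  rw [AlgPoints.toSpecHom_ofAlgHom, Spec.preimage_map]
  rfl

/-- `baseCoordFun` is onto: the point `ofAlgHom (aeval a)` has coordinates `a`. [cite: SerreGAGA1956, §2 n°5] -/
theorem surjective_baseCoordFun : Function.Surjective (baseCoordFun n d) := fun a =>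
  ⟨(AlgPoints.ofAlgHom (MvPolynomial.aeval a) : AlgPoints (specOver ℂ (CoeffRing ℂ n d)) ℂ), funext fun m => by
    change AlgPoints.toAlgHom (AlgPoints.ofAlgHom (MvPolynomial.aeval a) :
      AlgPoints (specOver ℂ (CoeffRing ℂ n d)) ℂ) (X m) = a m
    rw [toAlgHom_ofAlgHom_apply, MvPolynomial.aeval_X]⟩

/-- **`S^d(ℂ) → ℂ^N` is a homeomorphism** (continuous injective open surjection). [cite: SerreGAGA1956, §2 n°5] -/
theorem isHomeomorph_baseCoordFun : IsHomeomorph (baseCoordFun n d) := by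
  haveI := locallyOfFiniteType_affineBase_hom ℂ n d
  haveI := smoothOfRelativeDimension_affineBase_hom ℂ n d
  have hne : (Set.univ : Set (ComplexPoints (affineBase ℂ n d))).Nonempty := by
    obtain ⟨P, -⟩ := surjective_baseCoordFun n d 0
    exact ⟨P, Set.mem_univ P⟩
  obtain ⟨Φ, hΦ, hsrc, -, -, -⟩ := ComplexPoints.exists_openPartialHomeomorph_of_regular_injOn (X := affineBase ℂ n d)
    isOpen_univ hne rfl (regular_baseCoordFun n d) (injective_baseCoordFun n d).injOn
  have hcont : Continuous (baseCoordFun n d) := by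
    rw [← hΦ, ← continuousOn_univ, ← hsrc]; exact Φ.continuousOn
  refine ⟨hcont, ?_, injective_baseCoordFun n d, surjective_baseCoordFun n d⟩
  · have hopen : IsOpenMap ((Set.univ : Set (ComplexPoints (affineBase ℂ n d))).restrict (baseCoordFun n d)) :=
      ComplexPoints.isOpenMap_restrict_of_regular_injOn (X := affineBase ℂ n d) isOpen_univ rfl
        (regular_baseCoordFun n d) (injective_baseCoordFun n d).injOn
    intro U hU
    have h := hopen (Subtype.val ⁻¹' U) (hU.preimage continuous_subtype_val)
    have himg : (Set.univ : Set (ComplexPoints (affineBase ℂ n d))).restrict (baseCoordFun n d) '' (Subtype.val ⁻¹' U) =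
        baseCoordFun n d '' U := by
      ext y
      constructor
      · rintro ⟨⟨Q, hQ⟩, hQU, rfl⟩; exact ⟨Q, hQU, rfl⟩
      · rintro ⟨Q, hQU, rfl⟩; exact ⟨⟨Q, Set.mem_univ Q⟩, hQU, rfl⟩
    rwa [himg] at h

/-- `S^d(ℂ) → ℂ^N` is a proper map. [cite: SerreGAGA1956, §2 n°5] -/
theorem isProperMap_baseCoordFun : IsProperMap (baseCoordFun n d) :=
  ((isHomeomorph_baseCoordFun n d).homeomorph (baseCoordFun n d)).isProperMap

end Base

/-! ### §2 `𝒴(ℂ) → ℂ^N` is proper -/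

section Proper

variable (k : Type u) [Field k] (n d : ℕ)

/-- `𝒴 → S^d` as a morphism of `k`-schemes. [cite: VoisinHodgeII2003, §6.2.1] -/
def tOverToAffine : totalSpaceOver k n d ⟶ affineBase k n d :=
  Over.homMk (totalOverToSpec' k n d) rfl

/-- `(tOverToAffine).left = totalOverToSpec'` (`rfl`). [cite: VoisinHodgeII2003, §6.2.1] -/
theorem tOverToAffine_left : (tOverToAffine k n d).left = totalOverToSpec' k n d := rfl

/-- `𝒴 → S^d` is proper. [cite: Hartshorne1977, II Thm. 4.9] -/
theorem isProper_tOverToAffine_left : IsProper (tOverToAffine k n d).left :=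
  inferInstanceAs (IsProper (totalToSpec k n d))

/-- `regularToTotalSpaceOver ≫ tOverToAffine = regularFamily`. [cite: VoisinHodgeII2003, §6.2.1] -/
theorem regularToTotalSpaceOver_comp_tOverToAffine :
    regularToTotalSpaceOver k n d ≫ tOverToAffine k n d = regularFamily k n d :=
  Over.OverMorphism.ext rfl

variable {K : Type u} [Field K] [Algebra k K]

/-- The coefficient homomorphism of `P` is the algebra map underlying the point `ψ(P)` of `S^d` (`rfl`).
[cite: Hartshorne1977, II Ex. 2.7] -/
theorem tPointHom_hom_eq_toAlgHom (P : AlgPoints (totalSpaceOver k n d) K) :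
    (tPointHom k n d P).hom =
      (AlgPoints.toAlgHom (AlgPoints.map (tOverToAffine k n d) P : AlgPoints (specOver k (CoeffRing k n d)) K)).toRingHom :=
  rfl

end Proper

section ProperComplex

variable (n d : ℕ)

/-- `tCoeff = baseCoordFun ∘ ψ(ℂ)`. [cite: VoisinHodgeII2003, §6.2.1] -/
theorem tCoeff_eq_baseCoordFun_map (P : ComplexPoints (totalSpaceOver ℂ n d)) :
    tCoeff ℂ n d P = baseCoordFun n d (AlgPoints.map (tOverToAffine ℂ n d) P) := by
  funext m
  change (tPointHom ℂ n d P).hom (X m) = _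
  rw [tPointHom_hom_eq_toAlgHom]
  rfl

/-- `ψ(ℂ) : 𝒴(ℂ) → S^d(ℂ)` is a proper map. [cite: SGA1, Exp. XII Prop. 3.2 (v)] -/
theorem isProperMap_map_tOverToAffine :
    IsProperMap (AlgPoints.map (tOverToAffine ℂ n d) : ComplexPoints (totalSpaceOver ℂ n d) → _) := by
  haveI : IsProper (tOverToAffine ℂ n d).left := isProper_tOverToAffine_left ℂ n d
  haveI : UniversallyClosed (tOverToAffine ℂ n d).left := IsProper.toUniversallyClosed
  haveI : QuasiCompact (tOverToAffine ℂ n d).left := inferInstance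
  exact AlgPoints.isProperMap_map (tOverToAffine ℂ n d)

/-- **The coefficient map `𝒴(ℂ) → ℂ^N` is proper.** [cite: SGA1, Exp. XII Prop. 3.2 (v)] -/
theorem isProperMap_tCoeff : IsProperMap (fun P : ComplexPoints (totalSpaceOver ℂ n d) => tCoeff ℂ n d P) := by
  have h : (fun P : ComplexPoints (totalSpaceOver ℂ n d) => tCoeff ℂ n d P) =
      baseCoordFun n d ∘ AlgPoints.map (tOverToAffine ℂ n d) := funext fun P => tCoeff_eq_baseCoordFun_map n d P
  rw [h]
  exact (isProperMap_baseCoordFun n d).comp (isProperMap_map_tOverToAffine n d)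

/-- The coefficient map is continuous. [cite: SerreGAGA1956, §2 n°5] -/
theorem continuous_tCoeff : Continuous fun P : ComplexPoints (totalSpaceOver ℂ n d) => tCoeff ℂ n d P :=
  (isProperMap_tCoeff n d).continuous

end ProperComplex

/-! ### §3 Proper maps: closed sets over a point are controlled over a neighbourhood -/

/-- **For a proper `π`, a closed `S` and an open `N ⊇ S ∩ π⁻¹(y₀)`, some open `V ∋ y₀` has `S ∩ π⁻¹(V) ⊆ N`** (the image of the
closed `S ∖ N` is closed and misses `y₀`). [cite: VoisinHodgeII2003, §2.3.1] -/
theorem exists_open_nhds_inter_preimage_subset {X Y : Type*} [TopologicalSpace X] [TopologicalSpace Y] {π : X → Y}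
    (hπ : IsProperMap π) {S N : Set X} (hS : IsClosed S) (hN : IsOpen N) {y₀ : Y} (h : ∀ x ∈ S, π x = y₀ → x ∈ N) :
    ∃ V : Set Y, IsOpen V ∧ y₀ ∈ V ∧ ∀ x ∈ S, π x ∈ V → x ∈ N := by
  have hc : IsClosed (π '' (S \ N)) := hπ.isClosedMap _ (hS.sdiff hN)
  refine ⟨(π '' (S \ N))ᶜ, hc.isOpen_compl, ?_, fun x hx hxV => ?_⟩
  · rintro ⟨x, ⟨hxS, hxN⟩, hxy⟩
    exact hxN (h x hxS hxy)
  · by_contra hxN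
    exact hxV ⟨x, ⟨hx, hxN⟩, rfl⟩

/-! ### §4 The fibre-singular points -/

section Singular

variable (n d : ℕ)

/-- The fibre-singular points `𝒴(ℂ) ∖ 𝒴°(ℂ)` form a closed subset of `𝒴(ℂ)` (the regular locus is open).
[cite: VoisinHodgeII2003, §2.3.1] -/
theorem isClosed_compl_range_map_regularToTotalSpaceOver :
    IsClosed (Set.range (AlgPoints.map (regularToTotalSpaceOver ℂ n d) :
      ComplexPoints (regularTotal ℂ n d) → ComplexPoints (totalSpaceOver ℂ n d)))ᶜ :=
  (isOpenEmbedding_map_regularToTotalSpaceOver ℂ n d (L := ℂ)).isOpen_range.isClosed_compl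

/-- **Upper semicontinuity of the singular set**: if every fibre-singular point over `b₀` lies in the open `N ⊆ 𝒴(ℂ)`, then there is an
open `V ∋ b₀` such that every fibre-singular point with coefficients in `V` lies in `N`. [cite: VoisinHodgeII2003, §2.3.1] -/
theorem exists_open_nhds_singular_subset {N : Set (ComplexPoints (totalSpaceOver ℂ n d))} (hN : IsOpen N) {b₀ : DegIndex n d → ℂ}
    (h : ∀ P : ComplexPoints (totalSpaceOver ℂ n d),
      P ∉ Set.range (AlgPoints.map (regularToTotalSpaceOver ℂ n d) : ComplexPoints (regularTotal ℂ n d) → _) →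
        tCoeff ℂ n d P = b₀ → P ∈ N) :
    ∃ V : Set (DegIndex n d → ℂ), IsOpen V ∧ b₀ ∈ V ∧
      ∀ P : ComplexPoints (totalSpaceOver ℂ n d),
        P ∉ Set.range (AlgPoints.map (regularToTotalSpaceOver ℂ n d) : ComplexPoints (regularTotal ℂ n d) → _) →
          tCoeff ℂ n d P ∈ V → P ∈ N :=
  exists_open_nhds_inter_preimage_subset (isProperMap_tCoeff n d) (isClosed_compl_range_map_regularToTotalSpaceOver n d) hN
    (fun P hP hPb => h P hP hPb)

/-! ### §5 Compactness away from the singular points -/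

/-- **Compactness in `𝒴°(ℂ)` away from the singular points**: if `K ⊆ ℂ^N` is compact and every fibre-singular point with
coefficients in `K` lies in the open `N ⊆ 𝒴(ℂ)`, then `{Q ∈ 𝒴°(ℂ) | b(Q) ∈ K, Q ∉ N}` is compact (a closed subset of the compact
`b⁻¹(K) ⊆ 𝒴(ℂ)` inside the image of the open embedding `𝒴°(ℂ) ↪ 𝒴(ℂ)`). [cite: SGA1, Exp. XII Prop. 3.2 (v)] [cite: VoisinHodgeII2003, §2.3.1] -/
theorem isCompact_setOf_regCoeff_mem_of_forall_singular {K : Set (DegIndex n d → ℂ)} (hK : IsCompact K)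
    {N : Set (ComplexPoints (totalSpaceOver ℂ n d))} (hN : IsOpen N)
    (h : ∀ P : ComplexPoints (totalSpaceOver ℂ n d),
      P ∉ Set.range (AlgPoints.map (regularToTotalSpaceOver ℂ n d) : ComplexPoints (regularTotal ℂ n d) → _) →
        tCoeff ℂ n d P ∈ K → P ∈ N) :
    IsCompact {Q : ComplexPoints (regularTotal ℂ n d) |
      regCoeff ℂ n d Q ∈ K ∧ AlgPoints.map (regularToTotalSpaceOver ℂ n d) Q ∉ N} := by
  set e := (AlgPoints.map (regularToTotalSpaceOver ℂ n d) : ComplexPoints (regularTotal ℂ n d) →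
    ComplexPoints (totalSpaceOver ℂ n d)) with he
  have hemb := isOpenEmbedding_map_regularToTotalSpaceOver ℂ n d (L := ℂ)
  -- the compact `T = b⁻¹(K) ∖ N ⊆ 𝒴(ℂ)`
  set T : Set (ComplexPoints (totalSpaceOver ℂ n d)) := {P | tCoeff ℂ n d P ∈ K} \ N with hT
  have hTc : IsCompact T := ((isProperMap_tCoeff n d).isCompact_preimage hK).diff hN
  have hTsub : T ⊆ Set.range e := fun P hP => by
    by_contra hPr
    exact hP.2 (h P hPr hP.1)
  have hpre : {Q : ComplexPoints (regularTotal ℂ n d) | regCoeff ℂ n d Q ∈ K ∧ e Q ∉ N} = e ⁻¹' T := by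
    ext Q
    simp only [hT, Set.mem_setOf_eq, Set.mem_preimage, Set.mem_sdiff, he, tCoeff_map_regularToTotalSpaceOver]
  rw [hpre, hemb.isEmbedding.isInducing.isCompact_iff, Set.image_preimage_eq_of_subset hTsub]
  exact hTc

end Singular

end Literature.AlgebraicGeometry.Motives.UniversalHypersurface

end
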